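import Summits.Ventures.PercRepro.RankLevelSetLevelNineMult4
import Summits.Ventures.PercRepro.RankLevelSetPlaneTenPrime
import Summits.Ventures.PercRepro.S2FlatTail
import Summits.Ventures.PercRepro.S4TailFiveHalves
import Summits.Ventures.PercRepro.S4FlatBoundsSharp
import Summits.Ventures.PercRepro.RankLevelSetLevelNinePartThree
import Summits.Ventures.PercRepro.S2CubeGiantCount
import Summits.Ventures.PercRepro.RankLevelSetCoreGeneralSharp
import Summits.Ventures.PercRepro.RankLevelSetLevelNineArithCubeZ
import Summits.Ventures.PercRepro.RankLevelSetLevelNineCubeTailsD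

/-!
# PercRepro — THEOREM C₉ ON THE PARTITION CHAIN WITH THE CUBIC MULTIPLICITY: C-025 AT LEVEL `9` FOR EVERY FINITE
MATROID AND EVERY `p ≥ 382`, GIVEN LEVEL `8` FROM `381` — UNCONDITIONAL ON THE `328` ROW (p4, gen 16; a feeder for S4)

The level-`9` partition chain of RankLevelSetLevelNinePartThree (the three-multiplicity, `p ≥ 738`) re-assembled on p7's
partition-form giant count with the CUBIC multiplicity `ν + 3·C(ν, 2) + 3·C(ν, 3)` (`S2.ncard_eRk_eq_ncard_le_le_giant_cube'`,
S2CubeGiantCount), the same caps `f = min 319 (9 + d)`, `f′ = min 159 (8 + d)`, `ν_∩ = min 151 d`, LEMMAS T / T4, the 320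
polynomial inequalities `level_nine_poly_cube` (RankLevelSetLevelNineArithCubeAA … BN, ZA / ZB / Z; certificate at `p ≥ 381`,
binding `d = 151`), and the large-corank regime with the floor `B + 2` (`c025_core_nine_beyond_sharp`, `349 ≤ p`, corank
`> 329`). `Y`-side at `p ≥ 381`: for `d ≤ 249` the uniform tails (`32·F₉(n) ≤ 2^n` from `n ≥ 380`, the `5/2` tail); for
`250 ≤ d ≤ 329` the combined numerical bases `8·G₉(d, 381 + d) ≤ 2^{381 + d}` (RankLevelSetLevelNineCubeTailsA … D).
* **`c025_core_nine_bounded_corank_cube`** — the `e`-free core at level `9`, corank `10 ≤ d ≤ 329`, rank `p ≥ 381`;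
* **`c025_nine_of_eight_cube`** — level `8` for all `p ≥ 381` implies level `9` for all `p ≥ 382`;
* **`c025_nine_large_cube'`** — UNCONDITIONAL over the tree: level `9` for every `p ≥ 382` (level `8` from `328` by
  RankLevelSetLevelEightPartThree's `c025_eight_large_part3'`, d2178; the cubic level-`8` chain is not needed).
Axioms: standard.
-/

set_option exponentiation.threshold 1024

open scoped Matroid

namespace PercRepro

namespace ThmN

open Set

variable {α : Type}

set_option maxHeartbeats 1600000 in
/-- **The `e`-free core at level `9`, corank `10 ≤ d ≤ 329`, rank `p ≥ 381`** (the partition count with the sharpened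
multiplicity, the nullity cap, `f(9) ≤ 319`, `f(8) ≤ 159`, Lemmas T and T4; the rank-`≤ 9` sets through their closures
and the `5/2` tail on the `Y`-side). -/
theorem c025_core_nine_bounded_corank_cube (M : Matroid α) [M.Finite] (p d : ℕ) (hp : 381 ≤ p) (hd10 : 10 ≤ d)
    (hd329 : d ≤ 329) (hR : M.eRank = (p : ℕ∞)) (hn : M.E.ncard = p + d)
    (hfree : ∀ e ∈ M.E, ∃ A ⊆ M.E \ {e}, e ∉ M.closure A ∧ e ∉ M.closure ((M.E \ {e}) \ A)) :
    RLS M p 9 := by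
  classical
  have hEcard : M.ground_finite.toFinset.card = p + d := by
    rw [← Set.ncard_eq_toFinset_card _ M.ground_finite]; exact hn
  have hL0 : ∀ e ∈ M.E, ¬ M.IsLoop e := not_isLoop_of_free M hfree
  have hs : ∀ e ∈ M.E, ∀ f ∈ M.E, e ≠ f → M.eRk {e, f} = 2 := by
    intro e he f hf hef
    have h2 : (2 : ℕ∞) ≤ M.eRk {e, f} :=
      two_le_eRk_of_two_le_ncard_of_free M hfree (pair_subset he hf) (by rw [ncard_pair hef])
    have h3 : M.eRk {e, f} ≤ 2 := by
      have := M.eRk_le_encard {e, f}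
      rwa [encard_pair hef] at this
    exact le_antisymm h3 h2
  have hcirc : ∀ C, M.IsCircuit C → 3 ≤ C.encard := three_le_encard_of_circuit M hL0 hs
  have hd : M.E.encard = M.eRank + d := by
    rw [hR, ← M.ground_finite.cast_ncard_eq, hn]
    push_cast
    ring
  have hcap : ∀ X ⊆ M.E, ∀ k : ℕ, M.eRk X ≤ k → X.ncard ≤ k + d := by
    intro X hX k hr
    have h1 := Matroid.encard_le_eRk_add_of_encard_eq hX hd
    have h2 : X.encard ≤ (k : ℕ∞) + d := h1.trans (by gcongr)
    have hfin : X.Finite := M.ground_finite.subset hX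
    rw [← hfin.cast_ncard_eq] at h2
    exact_mod_cast h2
  -- rank-`≤ 9` sets have `≤ min 319 (9 + d)` points, rank-`≤ 8` sets `≤ min 159 (8 + d)`
  have hflat : ∀ X ⊆ M.E, M.eRk X ≤ 9 → X.ncard ≤ min 319 (9 + d) :=
    fun X hX hr => le_min (ncard_le_three_nineteen_of_eRk_le_nine_of_free M hfree X hX hr) (hcap X hX 9 hr)
  have hflat' : ∀ X ⊆ M.E, M.eRk X ≤ ((9 - 1 : ℕ) : ℕ∞) → X.ncard ≤ min 159 (8 + d) :=
    fun X hX hr => le_min (ncard_le_one_fifty_nine_of_eRk_le_eight_of_free M hfree X hX (by simpa using hr))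
      (hcap X hX 8 (by simpa using hr))
  have hinter := hinter_nine M hd hfree
  have hC1 : ∀ L ⊆ M.E, M.eRk L = 2 → L.ncard ≤ 3 :=
    fun L hL hr => ncard_le_three_of_eRk_two M hs hfree hL hr
  have hC1' : ∀ L ⊆ M.E, M.eRk L ≤ 2 → L.ncard ≤ 3 := by
    intro L hL' hr
    have := ncard_add_one_le_two_pow_of_eRk_le M hL0 hfree 2 L hL' hr
    omega
  have hC2 : ∀ P ⊆ M.E, M.eRk P ≤ 3 → P.ncard ≤ 6 :=
    fun P hP hr => ncard_le_six_of_eRk_le_three_of_free M hfree hP hr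
  have hs3 : {C | M.IsCircuit C ∧ C.ncard = 3}.ncard ≤ d * (d + 1) / 2 := by
    have hT : 2 * {C | M.IsCircuit C ∧ C.ncard = 3}.ncard ≤ d * (d + 1) := S1.two_mul_ncard_triangles_le M hC1 hd
    omega
  have hs4 : {C | M.IsCircuit C ∧ C.ncard = 4}.ncard ≤ d * (d + 1) * (d + 2) / 3 := by
    have hT4 : 3 * {C : Set α | M.IsCircuit C ∧ C.ncard = 4}.ncard ≤ d * (d + 1) * (d + 2) :=
      S1.three_mul_ncard_four_circuits_le M hC1' hC2 hd
    omega
  have hs5 : {C | M.IsCircuit C ∧ C.ncard = 5}.ncard ≤ (d + 4).choose 5 :=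
    Matroid.ncard_circuits_le_choose_of_encard M hd 4
  have hs6 : {C | M.IsCircuit C ∧ C.ncard = 6}.ncard ≤ (d + 5).choose 6 :=
    Matroid.ncard_circuits_le_choose_of_encard M hd 5
  have hs7 : {C | M.IsCircuit C ∧ C.ncard = 7}.ncard ≤ (d + 6).choose 7 :=
    Matroid.ncard_circuits_le_choose_of_encard M hd 6
  have hs8 : {C | M.IsCircuit C ∧ C.ncard = 8}.ncard ≤ (d + 7).choose 8 :=
    Matroid.ncard_circuits_le_choose_of_encard M hd 7
  have hs9 : {C | M.IsCircuit C ∧ C.ncard = 9}.ncard ≤ (d + 8).choose 9 :=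
    Matroid.ncard_circuits_le_choose_of_encard M hd 8
  have hs10 : {C | M.IsCircuit C ∧ C.ncard = 10}.ncard ≤ (d + 9).choose 10 :=
    Matroid.ncard_circuits_le_choose_of_encard M hd 9
  -- (U): the partition count with the three-multiplicity, in `ℚ`, then the circuit bounds
  have hU0 := S2.ncard_eRk_eq_ncard_le_le_giant_cube' M 9 (min 319 (9 + d)) (min 159 (8 + d))
    (max ((d + min 151 d) / 2 + 1) (min 150 (d - 1) + 2)) (min 151 d)
    (by norm_num) hcirc hC1 hflat hflat' hinter hd (by omega) (by omega) (by omega)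
  have hU1 := Matroid.topCount_le_ncard_compl (M := M) hR hd 9
  have hm1 : min (min 319 (9 + d) - (9 + 1)) (max ((d + min 151 d) / 2 + 1) (min 150 (d - 1) + 2) - 2) =
      min 309 (max ((d + min 151 d) / 2 + 1) (min 150 (d - 1) + 2) - 2) := by omega
  have hm2 : min 159 (8 + d) - 9 = min 150 (d - 1) := by omega
  have hm3 : min (min 319 (9 + d)) (9 + d) = min 319 (9 + d) := by omega
  rw [hn, sum_Icc_three_ten_q, sum_Icc_three_ten_q, hm1, hm2, hm3,
    show d - (9 + 1) + 1 = d - 9 by omega] at hU0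
  simp only [show (9 : ℕ) + 1 = 10 from rfl, show (10 : ℕ) - 3 = 7 from rfl, show (10 : ℕ) - 4 = 6 from rfl,
    show (10 : ℕ) - 5 = 5 from rfl, show (10 : ℕ) - 6 = 4 from rfl, show (10 : ℕ) - 7 = 3 from rfl,
    show (10 : ℕ) - 8 = 2 from rfl, show (10 : ℕ) - 9 = 1 from rfl, show (10 : ℕ) - 10 = 0 from rfl,
    Nat.choose_one_right, Nat.choose_zero_right] at hU0
  have hUq : (Matroid.topCount M p 9 : ℚ) ≤ ((p + d).choose 9 : ℚ) +
      (∑ j ∈ Finset.range (d - 9), ((Nat.choose (min 309 (max ((d + min 151 d) / 2 + 1) (min 150 (d - 1) + 2) - 2)) j : ℕ) : ℚ) / (((j + 1) + 3 * (j + 1).choose 2 + 3 * (j + 1).choose 3 : ℕ) : ℚ)) *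
        (((d * (d + 1) / 2 : ℕ) : ℚ) * ((p + d).choose 7 : ℚ) + ((d * (d + 1) * (d + 2) / 3 : ℕ) : ℚ) * ((p + d).choose 6 : ℚ) +
          (((d + 4).choose 5 : ℕ) : ℚ) * ((p + d).choose 5 : ℚ) + (((d + 5).choose 6 : ℕ) : ℚ) * ((p + d).choose 4 : ℚ) +
          (((d + 6).choose 7 : ℕ) : ℚ) * ((p + d).choose 3 : ℚ) + (((d + 7).choose 8 : ℕ) : ℚ) * ((p + d).choose 2 : ℚ) +
          (((d + 8).choose 9 : ℕ) : ℚ) * (p + d : ℚ) + (((d + 9).choose 10 : ℕ) : ℚ)) +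
      ((∑ j ∈ Finset.range (d - 9), ((Nat.choose (min 319 (9 + d) - 10) j : ℕ) : ℚ) / (((j + 1) + 3 * (j + 1).choose 2 + 3 * (j + 1).choose 3 : ℕ) : ℚ)) -
        (∑ j ∈ Finset.range (d - 9), ((Nat.choose (min 150 (d - 1)) j : ℕ) : ℚ) / (((j + 1) + 3 * (j + 1).choose 2 + 3 * (j + 1).choose 3 : ℕ) : ℚ))) *
        ((d * (d + 1) / 2 * (min 319 (9 + d)).choose 7 + d * (d + 1) * (d + 2) / 3 * (min 319 (9 + d)).choose 6 +
          (d + 4).choose 5 * (min 319 (9 + d)).choose 5 + (d + 5).choose 6 * (min 319 (9 + d)).choose 4 +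
          (d + 6).choose 7 * (min 319 (9 + d)).choose 3 + (d + 7).choose 8 * (min 319 (9 + d)).choose 2 + (d + 8).choose 9 * (min 319 (9 + d)) +
          (d + 9).choose 10 : ℕ) : ℚ) := by
    have hU1q : (Matroid.topCount M p 9 : ℚ) ≤
        ({B : Set α | B ⊆ M.E ∧ M.eRk B = 9 ∧ B.ncard ≤ d}.ncard : ℚ) := by exact_mod_cast hU1
    have hsm : {C | M.IsCircuit C ∧ C.ncard = 3}.ncard * (p + d).choose 7 +
        {C | M.IsCircuit C ∧ C.ncard = 4}.ncard * (p + d).choose 6 +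
        {C | M.IsCircuit C ∧ C.ncard = 5}.ncard * (p + d).choose 5 +
        {C | M.IsCircuit C ∧ C.ncard = 6}.ncard * (p + d).choose 4 +
        {C | M.IsCircuit C ∧ C.ncard = 7}.ncard * (p + d).choose 3 +
        {C | M.IsCircuit C ∧ C.ncard = 8}.ncard * (p + d).choose 2 +
        {C | M.IsCircuit C ∧ C.ncard = 9}.ncard * (p + d) + {C | M.IsCircuit C ∧ C.ncard = 10}.ncard * 1 ≤
        d * (d + 1) / 2 * (p + d).choose 7 + d * (d + 1) * (d + 2) / 3 * (p + d).choose 6 +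
          (d + 4).choose 5 * (p + d).choose 5 + (d + 5).choose 6 * (p + d).choose 4 +
          (d + 6).choose 7 * (p + d).choose 3 + (d + 7).choose 8 * (p + d).choose 2 + (d + 8).choose 9 * (p + d) + (d + 9).choose 10 := by
      have := hs10
      gcongr
      omega
    have hgg : {C | M.IsCircuit C ∧ C.ncard = 3}.ncard * (min 319 (9 + d)).choose 7 +
        {C | M.IsCircuit C ∧ C.ncard = 4}.ncard * (min 319 (9 + d)).choose 6 +
        {C | M.IsCircuit C ∧ C.ncard = 5}.ncard * (min 319 (9 + d)).choose 5 +
        {C | M.IsCircuit C ∧ C.ncard = 6}.ncard * (min 319 (9 + d)).choose 4 +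
        {C | M.IsCircuit C ∧ C.ncard = 7}.ncard * (min 319 (9 + d)).choose 3 +
        {C | M.IsCircuit C ∧ C.ncard = 8}.ncard * (min 319 (9 + d)).choose 2 +
        {C | M.IsCircuit C ∧ C.ncard = 9}.ncard * (min 319 (9 + d)) + {C | M.IsCircuit C ∧ C.ncard = 10}.ncard * 1 ≤
        d * (d + 1) / 2 * (min 319 (9 + d)).choose 7 + d * (d + 1) * (d + 2) / 3 * (min 319 (9 + d)).choose 6 +
          (d + 4).choose 5 * (min 319 (9 + d)).choose 5 + (d + 5).choose 6 * (min 319 (9 + d)).choose 4 +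
          (d + 6).choose 7 * (min 319 (9 + d)).choose 3 + (d + 7).choose 8 * (min 319 (9 + d)).choose 2 + (d + 8).choose 9 * (min 319 (9 + d)) + (d + 9).choose 10 := by
      gcongr
      omega
    have hsmq : (({C | M.IsCircuit C ∧ C.ncard = 3}.ncard : ℚ) * ((p + d).choose 7 : ℚ) +
        ({C | M.IsCircuit C ∧ C.ncard = 4}.ncard : ℚ) * ((p + d).choose 6 : ℚ) +
        ({C | M.IsCircuit C ∧ C.ncard = 5}.ncard : ℚ) * ((p + d).choose 5 : ℚ) +
        ({C | M.IsCircuit C ∧ C.ncard = 6}.ncard : ℚ) * ((p + d).choose 4 : ℚ) +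
        ({C | M.IsCircuit C ∧ C.ncard = 7}.ncard : ℚ) * ((p + d).choose 3 : ℚ) +
        ({C | M.IsCircuit C ∧ C.ncard = 8}.ncard : ℚ) * ((p + d).choose 2 : ℚ) +
        ({C | M.IsCircuit C ∧ C.ncard = 9}.ncard : ℚ) * ((p + d : ℕ) : ℚ) +
        ({C | M.IsCircuit C ∧ C.ncard = 10}.ncard : ℚ) * ((1 : ℕ) : ℚ)) ≤
        ((d * (d + 1) / 2 * (p + d).choose 7 + d * (d + 1) * (d + 2) / 3 * (p + d).choose 6 +
          (d + 4).choose 5 * (p + d).choose 5 + (d + 5).choose 6 * (p + d).choose 4 +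
          (d + 6).choose 7 * (p + d).choose 3 + (d + 7).choose 8 * (p + d).choose 2 + (d + 8).choose 9 * (p + d) + (d + 9).choose 10 : ℕ) : ℚ) := by
      exact_mod_cast hsm
    have hggq : (({C | M.IsCircuit C ∧ C.ncard = 3}.ncard : ℚ) * ((min 319 (9 + d)).choose 7 : ℚ) +
        ({C | M.IsCircuit C ∧ C.ncard = 4}.ncard : ℚ) * ((min 319 (9 + d)).choose 6 : ℚ) +
        ({C | M.IsCircuit C ∧ C.ncard = 5}.ncard : ℚ) * ((min 319 (9 + d)).choose 5 : ℚ) +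
        ({C | M.IsCircuit C ∧ C.ncard = 6}.ncard : ℚ) * ((min 319 (9 + d)).choose 4 : ℚ) +
        ({C | M.IsCircuit C ∧ C.ncard = 7}.ncard : ℚ) * ((min 319 (9 + d)).choose 3 : ℚ) +
        ({C | M.IsCircuit C ∧ C.ncard = 8}.ncard : ℚ) * ((min 319 (9 + d)).choose 2 : ℚ) +
        ({C | M.IsCircuit C ∧ C.ncard = 9}.ncard : ℚ) * (((min 319 (9 + d)) : ℕ) : ℚ) +
        ({C | M.IsCircuit C ∧ C.ncard = 10}.ncard : ℚ) * ((1 : ℕ) : ℚ)) ≤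
        ((d * (d + 1) / 2 * (min 319 (9 + d)).choose 7 + d * (d + 1) * (d + 2) / 3 * (min 319 (9 + d)).choose 6 +
          (d + 4).choose 5 * (min 319 (9 + d)).choose 5 + (d + 5).choose 6 * (min 319 (9 + d)).choose 4 +
          (d + 6).choose 7 * (min 319 (9 + d)).choose 3 + (d + 7).choose 8 * (min 319 (9 + d)).choose 2 + (d + 8).choose 9 * (min 319 (9 + d)) + (d + 9).choose 10 : ℕ) : ℚ) := by exact_mod_cast hgg
    have hσ : (∑ j ∈ Finset.range (d - 9), ((Nat.choose (min 150 (d - 1)) j : ℕ) : ℚ) / (((j + 1) + 3 * (j + 1).choose 2 + 3 * (j + 1).choose 3 : ℕ) : ℚ)) ≤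
        ∑ j ∈ Finset.range (d - 9), ((Nat.choose (min 319 (9 + d) - 10) j : ℕ) : ℚ) / (((j + 1) + 3 * (j + 1).choose 2 + 3 * (j + 1).choose 3 : ℕ) : ℚ) := by
      apply Finset.sum_le_sum
      intro j _
      have : (min 150 (d - 1)).choose j ≤ (min 319 (9 + d) - 10).choose j := Nat.choose_le_choose j (by omega)
      have h' : ((min 150 (d - 1)).choose j : ℚ) ≤ ((min 319 (9 + d) - 10).choose j : ℚ) := by exact_mod_cast this
      exact div_le_div_of_nonneg_right h' (by positivity)
    have hσm0 : (0 : ℚ) ≤ ∑ j ∈ Finset.range (d - 9), ((Nat.choose (min 309 (max ((d + min 151 d) / 2 + 1) (min 150 (d - 1) + 2) - 2)) j : ℕ) : ℚ) / (((j + 1) + 3 * (j + 1).choose 2 + 3 * (j + 1).choose 3 : ℕ) : ℚ) :=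
      Finset.sum_nonneg (fun j _ => by positivity)
    refine hU1q.trans (hU0.trans ?_)
    have e1 := mul_le_mul_of_nonneg_left hsmq hσm0
    have e2 := mul_le_mul_of_nonneg_left hggq (by linarith : (0 : ℚ) ≤
      (∑ j ∈ Finset.range (d - 9), ((Nat.choose (min 319 (9 + d) - 10) j : ℕ) : ℚ) / (((j + 1) + 3 * (j + 1).choose 2 + 3 * (j + 1).choose 3 : ℕ) : ℚ)) -
        (∑ j ∈ Finset.range (d - 9), ((Nat.choose (min 150 (d - 1)) j : ℕ) : ℚ) / (((j + 1) + 3 * (j + 1).choose 2 + 3 * (j + 1).choose 3 : ℕ) : ℚ)))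
    push_cast at e1 e2 ⊢
    linarith
  -- (Y): the rank-`≤ 9` sets through their closures; the spanning sets by the `5/2` tail
  have hY := Matroid.two_pow_le_midCount_add (M := M) p 9 hR
  have hsum9 := S2.ncard_eRk_le_le_sum M 9
  simp only [Finset.sum_range_succ, Finset.sum_range_zero, zero_add] at hsum9
  have hB := Matroid.ncard_spanning_le (M := M) hd
  rw [hEcard] at hY hB
  have hAB : 8 * ({X : Set α | X ⊆ M.E ∧ M.eRk X ≤ 9}.ncard +
      {X : Set α | X ⊆ M.E ∧ M.eRk X = M.eRank}.ncard) ≤ 2 ^ (p + d) := by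
    rcases Nat.lt_or_ge d 250 with hlow | hhigh
    · -- `d ≤ 249`: the uniform tails (`n ≥ 380`, `5d + 14 ≤ 2n`)
      have h9 : {X : Set α | X ⊆ M.E ∧ M.eRk X = (9 : ℕ)}.ncard ≤ M.E.ncard.choose 9 * 2 ^ (319 - 9) :=
        S2.ncard_eRk_eq_le_choose_mul_two_pow M 9 319
          (fun X hX hr => ncard_le_three_nineteen_of_eRk_le_nine_of_free M hfree X hX (by exact_mod_cast hr))
      have h8 : {X : Set α | X ⊆ M.E ∧ M.eRk X = (8 : ℕ)}.ncard ≤ M.E.ncard.choose 8 * 2 ^ (159 - 8) :=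
        S2.ncard_eRk_eq_le_choose_mul_two_pow M 8 159
          (fun X hX hr => ncard_le_one_fifty_nine_of_eRk_le_eight_of_free M hfree X hX (by exact_mod_cast hr))
      have h7 : {X : Set α | X ⊆ M.E ∧ M.eRk X = (7 : ℕ)}.ncard ≤ M.E.ncard.choose 7 * 2 ^ (79 - 7) :=
        S2.ncard_eRk_eq_le_choose_mul_two_pow M 7 79
          (fun X hX hr => ncard_le_seventynine_of_eRk_le_seven_of_free M hfree X hX (by exact_mod_cast hr))
      have h6 : {X : Set α | X ⊆ M.E ∧ M.eRk X = (6 : ℕ)}.ncard ≤ M.E.ncard.choose 6 * 2 ^ (39 - 6) :=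
        S2.ncard_eRk_eq_le_choose_mul_two_pow M 6 39
          (fun X hX hr => ncard_le_thirtynine_of_eRk_le_six_of_free M hfree hX (by exact_mod_cast hr))
      have h5 : {X : Set α | X ⊆ M.E ∧ M.eRk X = (5 : ℕ)}.ncard ≤ M.E.ncard.choose 5 * 2 ^ (19 - 5) :=
        S2.ncard_eRk_eq_le_choose_mul_two_pow M 5 19
          (fun X hX hr => ncard_le_nineteen_of_eRk_le_five_of_free M hfree hX (by exact_mod_cast hr))
      have h4 : {X : Set α | X ⊆ M.E ∧ M.eRk X = (4 : ℕ)}.ncard ≤ M.E.ncard.choose 4 * 2 ^ (10 - 4) :=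
        S2.ncard_eRk_eq_le_choose_mul_two_pow M 4 10
          (fun X hX hr => ncard_le_ten_of_eRk_le_four_of_free M hfree hX (by exact_mod_cast hr))
      have h3 : {X : Set α | X ⊆ M.E ∧ M.eRk X = (3 : ℕ)}.ncard ≤ M.E.ncard.choose 3 * 2 ^ (6 - 3) :=
        S2.ncard_eRk_eq_le_choose_mul_two_pow M 3 6
          (fun X hX hr => ncard_le_six_of_eRk_le_three_of_free M hfree hX (by exact_mod_cast hr))
      have h2 : {X : Set α | X ⊆ M.E ∧ M.eRk X = (2 : ℕ)}.ncard ≤ M.E.ncard.choose 2 * 2 ^ (3 - 2) :=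
        S2.ncard_eRk_eq_le_choose_mul_two_pow M 2 3
          (fun X hX hr => by
            have := ncard_add_one_le_two_pow_of_eRk_le M hL0 hfree 2 X hX hr
            omega)
      have h1 : {X : Set α | X ⊆ M.E ∧ M.eRk X = (1 : ℕ)}.ncard ≤ M.E.ncard.choose 1 * 2 ^ (1 - 1) :=
        S2.ncard_eRk_eq_le_choose_mul_two_pow M 1 1
          (fun X hX hr => by
            have := ncard_add_one_le_two_pow_of_eRk_le M hL0 hfree 1 X hX hr
            omega)
      have h0 : {X : Set α | X ⊆ M.E ∧ M.eRk X = (0 : ℕ)}.ncard ≤ M.E.ncard.choose 0 * 2 ^ (0 - 0) :=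
        S2.ncard_eRk_eq_le_choose_mul_two_pow M 0 0
          (fun X hX hr => by
            have := ncard_add_one_le_two_pow_of_eRk_le M hL0 hfree 0 X hX hr
            omega)
      norm_num [Nat.choose_one_right] at h9 h8 h7 h6 h5 h4 h3 h2 h1 h0
      rw [hn] at h9 h8 h7 h6 h5 h4 h3 h2 h1
      have hA : {X : Set α | X ⊆ M.E ∧ M.eRk X ≤ 9}.ncard ≤
          (p + d).choose 9 * 2 ^ 310 + (p + d).choose 8 * 2 ^ 151 + (p + d).choose 7 * 2 ^ 72 + (p + d).choose 6 * 2 ^ 33 +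
            (p + d).choose 5 * 2 ^ 14 + (p + d).choose 4 * 2 ^ 6 + (p + d).choose 3 * 2 ^ 3 + (p + d).choose 2 * 2 + (p + d) + 1 := by
        push_cast at hsum9
        omega
      have hT1 := thirtytwo_mul_flatTail_nine_le (p + d) (by omega)
      have hT2 : 16 * ∑ j ∈ Finset.range (d + 1), (p + d).choose j ≤ 2 ^ (p + d) :=
        Explicit.sixteen_mul_sum_range_choose_le' d (p + d) (by omega)
      omega
    · -- `250 ≤ d ≤ 329`: the combined numerical bases
      have h9 : {X : Set α | X ⊆ M.E ∧ M.eRk X = (9 : ℕ)}.ncard ≤ M.E.ncard.choose 9 * 2 ^ (min 310 d) := by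
        have := S2.ncard_eRk_eq_le_choose_mul_two_pow M 9 (min 319 (9 + d))
          (fun X hX hr => hflat X hX (by exact_mod_cast hr))
        rwa [show min 319 (9 + d) - 9 = min 310 d by omega] at this
      have h8 : {X : Set α | X ⊆ M.E ∧ M.eRk X = (8 : ℕ)}.ncard ≤ M.E.ncard.choose 8 * 2 ^ (159 - 8) :=
        S2.ncard_eRk_eq_le_choose_mul_two_pow M 8 159
          (fun X hX hr => ncard_le_one_fifty_nine_of_eRk_le_eight_of_free M hfree X hX (by exact_mod_cast hr))
      have h7 : {X : Set α | X ⊆ M.E ∧ M.eRk X = (7 : ℕ)}.ncard ≤ M.E.ncard.choose 7 * 2 ^ (79 - 7) :=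
        S2.ncard_eRk_eq_le_choose_mul_two_pow M 7 79
          (fun X hX hr => ncard_le_seventynine_of_eRk_le_seven_of_free M hfree X hX (by exact_mod_cast hr))
      have h6 : {X : Set α | X ⊆ M.E ∧ M.eRk X = (6 : ℕ)}.ncard ≤ M.E.ncard.choose 6 * 2 ^ (39 - 6) :=
        S2.ncard_eRk_eq_le_choose_mul_two_pow M 6 39
          (fun X hX hr => ncard_le_thirtynine_of_eRk_le_six_of_free M hfree hX (by exact_mod_cast hr))
      have h5 : {X : Set α | X ⊆ M.E ∧ M.eRk X = (5 : ℕ)}.ncard ≤ M.E.ncard.choose 5 * 2 ^ (19 - 5) :=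
        S2.ncard_eRk_eq_le_choose_mul_two_pow M 5 19
          (fun X hX hr => ncard_le_nineteen_of_eRk_le_five_of_free M hfree hX (by exact_mod_cast hr))
      have h4 : {X : Set α | X ⊆ M.E ∧ M.eRk X = (4 : ℕ)}.ncard ≤ M.E.ncard.choose 4 * 2 ^ (10 - 4) :=
        S2.ncard_eRk_eq_le_choose_mul_two_pow M 4 10
          (fun X hX hr => ncard_le_ten_of_eRk_le_four_of_free M hfree hX (by exact_mod_cast hr))
      have h3 : {X : Set α | X ⊆ M.E ∧ M.eRk X = (3 : ℕ)}.ncard ≤ M.E.ncard.choose 3 * 2 ^ (6 - 3) :=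
        S2.ncard_eRk_eq_le_choose_mul_two_pow M 3 6
          (fun X hX hr => ncard_le_six_of_eRk_le_three_of_free M hfree hX (by exact_mod_cast hr))
      have h2 : {X : Set α | X ⊆ M.E ∧ M.eRk X = (2 : ℕ)}.ncard ≤ M.E.ncard.choose 2 * 2 ^ (3 - 2) :=
        S2.ncard_eRk_eq_le_choose_mul_two_pow M 2 3
          (fun X hX hr => by
            have := ncard_add_one_le_two_pow_of_eRk_le M hL0 hfree 2 X hX hr
            omega)
      have h1 : {X : Set α | X ⊆ M.E ∧ M.eRk X = (1 : ℕ)}.ncard ≤ M.E.ncard.choose 1 * 2 ^ (1 - 1) :=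
        S2.ncard_eRk_eq_le_choose_mul_two_pow M 1 1
          (fun X hX hr => by
            have := ncard_add_one_le_two_pow_of_eRk_le M hL0 hfree 1 X hX hr
            omega)
      have h0 : {X : Set α | X ⊆ M.E ∧ M.eRk X = (0 : ℕ)}.ncard ≤ M.E.ncard.choose 0 * 2 ^ (0 - 0) :=
        S2.ncard_eRk_eq_le_choose_mul_two_pow M 0 0
          (fun X hX hr => by
            have := ncard_add_one_le_two_pow_of_eRk_le M hL0 hfree 0 X hX hr
            omega)
      simp only [Nat.choose_one_right, Nat.choose_zero_right, Nat.sub_self, pow_zero, mul_one] at h1 h0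
      rw [hn] at h9 h8 h7 h6 h5 h4 h3 h2 h1
      have hT := eight_mul_tailG_le_cube_nine d (p + d) (by omega) (by omega) (by omega)
      push_cast at hsum9 h9 h8 h7 h6 h5 h4 h3 h2 h1 h0
      have hA : {X : Set α | X ⊆ M.E ∧ M.eRk X ≤ 9}.ncard ≤
          (p + d).choose 9 * 2 ^ (min 310 d) + (p + d).choose 8 * 2 ^ 151 + (p + d).choose 7 * 2 ^ 72 +
            (p + d).choose 6 * 2 ^ 33 + (p + d).choose 5 * 2 ^ 14 + (p + d).choose 4 * 2 ^ 6 + (p + d).choose 3 * 2 ^ 3 +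
            (p + d).choose 2 * 2 + (p + d) + 1 := by
        omega
      omega
  have hΦ := phiK_le_two_pow_div p 9
  rw [Nat.choose_symm_add] at hΦ
  have hpolyq := level_nine_poly_cube d hd10 hd329 p hp
  rw [add_assoc] at hpolyq hUq
  rw [RLS_iff]
  have hYq : (2 : ℚ) ^ (p + d) ≤ (Matroid.midCount M p 9 : ℚ) +
      ({X : Set α | X ⊆ M.E ∧ M.eRk X ≤ 9}.ncard : ℚ) +
      ({X : Set α | X ⊆ M.E ∧ M.eRk X = M.eRank}.ncard : ℚ) := by exact_mod_cast hY
  have hABq : 8 * (({X : Set α | X ⊆ M.E ∧ M.eRk X ≤ 9}.ncard : ℚ) +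
      ({X : Set α | X ⊆ M.E ∧ M.eRk X = M.eRank}.ncard : ℚ)) ≤ 2 ^ (p + d) := by exact_mod_cast hAB
  have hU0' : (0 : ℚ) ≤ (Matroid.topCount M p 9 : ℚ) := Nat.cast_nonneg _
  have hd9 : 9 ≤ d := by omega
  exact level_arith (p := p) (d := d) (n := p + d) (q := 9) rfl hd9 hΦ hU0' hUq hYq hABq hpolyq

/-- **THEOREM C₉ ON THE CUBIC PARTITION CHAIN, GIVEN LEVEL `8` FROM `P`**: for every `P ≥ 381`, level `8` for all
`p ≥ P` implies level `9` for all `p ≥ P + 1`. -/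
theorem c025_nine_of_eight_cube_from (P : ℕ) (hP : 381 ≤ P)
    (h8 : ∀ (M : Matroid α) [M.Finite] (p : ℕ), P ≤ p → RLS M p 8) :
    ∀ (M : Matroid α) [M.Finite] (p : ℕ), P + 1 ≤ p → RLS M p 9 := by
  intro M _ p hp
  refine rls_succ_large (α := α) 8 9 P ?_ ?_ ?_ M p hp (by omega)
  · intro M' _ p' hP' _
    exact h8 M' p' hP'
  · intro M' _ p' _ hn _
    rcases Nat.lt_or_ge M'.E.ncard (p' + 9) with h | h
    · exact RLS_of_ncard_lt M' h
    · exact RLS_of_ncard_eq M' (by omega)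
  · intro M' _ p' hP' hR hbig _ hfree
    rcases Nat.lt_or_ge M'.E.ncard (p' + 330) with h | h
    · exact c025_core_nine_bounded_corank_cube M' p' (M'.E.ncard - p') (by omega) (by omega) (by omega) hR
        (by omega) hfree
    · exact c025_core_nine_beyond_sharp M' p' (by omega) hR (by omega) hfree

/-- **THEOREM C₉ ON THE CUBIC PARTITION CHAIN, GIVEN LEVEL `8` FROM `381`**: level `8` for all `p ≥ 381` implies
level `9` for all `p ≥ 382`. -/
theorem c025_nine_of_eight_cube (h8 : ∀ (M : Matroid α) [M.Finite] (p : ℕ), 381 ≤ p → RLS M p 8) :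
    ∀ (M : Matroid α) [M.Finite] (p : ℕ), 382 ≤ p → RLS M p 9 :=
  c025_nine_of_eight_cube_from 381 le_rfl h8

/-- **THEOREM C₉ AT `382`, UNCONDITIONAL OVER THE TREE**: every finite matroid satisfies C-025 at level `9` for every
`p ≥ 382` — level `8` for `p ≥ 328` (`c025_eight_large_part3'`, d2178) through the wrapper at `P = 381`. -/
theorem c025_nine_large_cube' (M : Matroid α) [M.Finite] (p : ℕ) (hp : 382 ≤ p) : RLS M p 9 :=
  c025_nine_of_eight_cube (fun M' _ p' hp' => c025_eight_large_part3' M' p' (by omega)) M p hp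

/-- The same in the literal `C025` body: `phiK p 9 · #U(p, 9) ≤ #Y(p, 9)` for every finite matroid and every `p ≥ 382`. -/
theorem c025_nine_large_cube (M : Matroid α) [M.Finite] (p : ℕ) (hp : 382 ≤ p) :
    phiK p 9 * ({A : Set α | A ⊆ M.E ∧ M.eRk A = (p : ℕ∞) ∧ M.eRk (M.E \ A) = (9 : ℕ∞)}.ncard : ℚ) ≤
      ({A : Set α | A ⊆ M.E ∧ (9 : ℕ∞) < M.eRk A ∧ M.eRk A < (p : ℕ∞)}.ncard : ℚ) :=
  c025_nine_large_cube' M p hp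

end ThmN

end PercRepro
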